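import Literature.Geometry.Kaehler.ComplexTorusTwistedProductFunctorial
import HarnessLib

/-!
# Switching the factors of Debarre's construction: `(Y × Z)/graph(p) ≅ (Z × Y)/graph(p⁻¹)` as polarised tori
# (Auffarth 2016, Thm. 3.5, the `ℤ/2ℤ` of the case `u = n/2`)

Layer `Literature/Geometry/Kaehler`, namespace `Literature.Geometry.Kaehler.ComplexTorus`; lane `lit-hodgefound`
(Track 2 foundations library, Layer A4, row A4-77, seat `lit-hodgefound-skel-4`, FILE K of the row).  Sequel of
`ComplexTorusTwistedProductFunctorial.lean` (FILE H: the general descent of isomorphisms of polarised tori to quotients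
by corresponding finite subgroups, `IsPolarizedIso.exists_isPolarizedIso_quotientBy`) and of row A4-76 FILE A
`ComplexTorusAntisymplecticGraphQuotient.lean` (`graphSubgroup`, `IsAntisymplectic`, `IsAntisymplectic.symm`,
`isPrincipalPolarization_quotientBy_graphSubgroup`).  Everything is consumed BY NAME.

## Source, verbatim

R. Auffarth, *On a numerical characterization of non-simple principally polarized abelian varieties*, Math. Z. 282
(2016), held text `paper:arxiv-1507.08618`, §3 Thm. 3.5 (p. 9 L62–L66) and its proof (p. 10 L3):

> "If `n` is even and `u = n/2` then `Φ_{n/2,n/2}(D)` induces an isomorphism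
> `(𝒜_{n/2}(D) × 𝒜_{n/2}(D))/(ℤ/2ℤ ⋉ Sp(D)) → 𝒜^D_{u,n−u}` where `ℤ/2ℤ` interchanges the factors."
> "If `n` is even and `u = n/2`, then it is easy to see that switching the two factors leaves the fibers
> invariant."

(A. Iribar López, *Noether–Lefschetz cycles on the moduli space of abelian varieties*, Forum Math. Pi (2026), §2.2
Remark 11: "If `g` is even and `u = g/2`, then `δ̃ = δ`, and this has to be taken into account".)

## What is proved (theorems only; no definition, no named fact, net debt `0`)

For tori `Y = ComplexTorus Φ₁`, `Z = ComplexTorus Φ₂` with forms `ω₁`, `ω₂`, subgroups `K₁ ⊆ Y`, `K₂ ⊆ Z` and a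
group isomorphism `e : K₁ ≃ K₂`:

* §1 the exchange isomorphism `s : Y × Z ⥲ Z × Y` is an isomorphism of POLARISED tori
  `(Y × Z, ω₁ ⊞ ω₂) ⥲ (Z × Y, ω₂ ⊞ ω₁)` (`exists_isPolarizedIso_swap`, rational representation the block permutation
  matrix, analytic representation `(u, w) ↦ (w, u)`), exchanging `Y × 0 ↔ 0 × Y` and `0 × Z ↔ Z × 0`;
* §2 `s(graph(e)) = graph(e⁻¹)` (`apply_mem_graphSubgroup_symm_iff`);
* §3 MAIN (`exists_isPolarizedIso_quotientBy_graphSubgroup_swap`): `s` descends to an isomorphism of polarised tori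
  `((Y × Z)/graph(e), ω₁ ⊞ ω₂) ⥲ ((Z × Y)/graph(e⁻¹), ω₂ ⊞ ω₁)` with `k ∘ π = π' ∘ s`, carrying the image of `Y × 0`
  onto the image of `0 × Y` and that of `0 × Z` onto that of `Z × 0`; for Riemann forms and an ANTISYMPLECTIC
  `e : K(L₁) ≅ K(L₂)` both are Debarre's principally polarised twisted products (`e⁻¹` is antisymplectic,
  A4-76) — "switching the two factors leaves the fibers invariant" (`…_swap_of_isAntisymplectic`).

## References

* [Auffarth2016NonSimplePPAV] R. Auffarth, *On a numerical characterization of non-simple principally polarized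
  abelian varieties*, Math. Z. 282 (2016) 731–746, arXiv:1507.08618, §3 Thm. 3.5 (pp. 9–10).
* [IribarLopez2024NoetherLefschetzCycles] A. Iribar López, *Noether–Lefschetz cycles on the moduli space of abelian
  varieties*, Forum Math. Pi (2026), arXiv:2411.09910, §2.2 Lemma 10, Def. 4, Remark 11 (pp. 7–8).
* [Lange2023AbelianVarietiesComplex] H. Lange, *Abelian Varieties over the Complex Numbers* (2023), §1.1.2 Prop. 1.1.6
  (pp. 19–20), §2.4.4 Cor. 2.4.24 (p. 123), §3.1.2 Prop. 3.1.4 (p. 160), §6.2.2 (p. 304: the exchange morphism).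
-/

noncomputable section

open Complex Module Function Matrix
open scoped Manifold

namespace Literature.Geometry.Kaehler

namespace ComplexTorus

variable {ι₁ ι₂ : Type*} [Fintype ι₁] [Fintype ι₂] [DecidableEq ι₁] [DecidableEq ι₂]
  {E₁ E₂ : Type*} [NormedAddCommGroup E₁] [NormedSpace ℂ E₁] [NormedAddCommGroup E₂] [NormedSpace ℂ E₂]
  (Φ₁ : (ι₁ → ℝ) ≃L[ℝ] E₁) (Φ₂ : (ι₂ → ℝ) ≃L[ℝ] E₂) (ω₁ : E₁ [⋀^Fin 2]→L[ℝ] ℝ) (ω₂ : E₂ [⋀^Fin 2]→L[ℝ] ℝ)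

/-! ### §1 The exchange isomorphism `s : (Y × Z, ω₁ ⊞ ω₂) ⥲ (Z × Y, ω₂ ⊞ ω₁)` -/

/-- `S_{21} S_{12} = 1` for the block permutation matrices. [cite: Lange2023AbelianVarietiesComplex, §6.2.2 (p. 304: "`s²= 1`")] -/
private theorem swap_mul_swap_TPS :
    Matrix.fromBlocks (0 : Matrix ι₁ ι₂ ℤ) (1 : Matrix ι₁ ι₁ ℤ) (1 : Matrix ι₂ ι₂ ℤ) (0 : Matrix ι₂ ι₁ ℤ) *
      Matrix.fromBlocks (0 : Matrix ι₂ ι₁ ℤ) (1 : Matrix ι₂ ι₂ ℤ) (1 : Matrix ι₁ ι₁ ℤ) (0 : Matrix ι₁ ι₂ ℤ) = 1 := by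
  rw [Matrix.fromBlocks_multiply]
  simp only [Matrix.zero_mul, Matrix.mul_zero, Matrix.one_mul, zero_add, add_zero, Matrix.fromBlocks_one]

/-- `S_ℝ x = (x|ι₂, x|ι₁)`: the block permutation matrix exchanges the two halves of the lattice coordinates.
[cite: Lange2023AbelianVarietiesComplex, §6.2.2 (p. 304)] -/
private theorem swap_mulVec_TPS (x : ι₁ ⊕ ι₂ → ℝ) :
    (Matrix.fromBlocks (0 : Matrix ι₂ ι₁ ℤ) (1 : Matrix ι₂ ι₂ ℤ) (1 : Matrix ι₁ ι₁ ℤ) (0 : Matrix ι₁ ι₂ ℤ)).map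
        (Int.cast : ℤ → ℝ) *ᵥ x = Sum.elim (fun j ↦ x (Sum.inr j)) (fun i ↦ x (Sum.inl i)) := by
  have hM : (Matrix.fromBlocks (0 : Matrix ι₂ ι₁ ℤ) (1 : Matrix ι₂ ι₂ ℤ) (1 : Matrix ι₁ ι₁ ℤ) (0 : Matrix ι₁ ι₂ ℤ)).map
      (Int.cast : ℤ → ℝ) = Matrix.fromBlocks (0 : Matrix ι₂ ι₁ ℝ) (1 : Matrix ι₂ ι₂ ℝ) (1 : Matrix ι₁ ι₁ ℝ) (0 : Matrix ι₁ ι₂ ℝ) := by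
    rw [Matrix.fromBlocks_map, Matrix.map_one (Int.cast : ℤ → ℝ) Int.cast_zero Int.cast_one,
      Matrix.map_one (Int.cast : ℤ → ℝ) Int.cast_zero Int.cast_one, Matrix.map_zero (Int.cast : ℤ → ℝ) Int.cast_zero,
      Matrix.map_zero (Int.cast : ℤ → ℝ) Int.cast_zero]
  conv_lhs => rw [hM, ← Sum.elim_comp_inl_inr x]
  rw [Matrix.fromBlocks_mulVec, Matrix.one_mulVec, Matrix.one_mulVec, Matrix.zero_mulVec, Matrix.zero_mulVec,
    zero_add, add_zero]
  rfl

/-- `(Φ₂ × Φ₁)(S_ℝ x) = ((Φ₁ × Φ₂) x)` with the factors exchanged: the analytic representation of the exchange morphism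
is `(u, w) ↦ (w, u)`. [cite: Lange2023AbelianVarietiesComplex, §1.1.2 Prop. 1.1.6 (p. 19) and §6.2.2 (p. 304)] -/
theorem prodPeriod_swap_mulVec_eq_prodComm (x : ι₁ ⊕ ι₂ → ℝ) :
    prodPeriod Φ₂ Φ₁ ((Matrix.fromBlocks (0 : Matrix ι₂ ι₁ ℤ) (1 : Matrix ι₂ ι₂ ℤ) (1 : Matrix ι₁ ι₁ ℤ) (0 : Matrix ι₁ ι₂ ℤ)).map
        (Int.cast : ℤ → ℝ) *ᵥ x) =
      (ContinuousLinearEquiv.prodComm ℂ E₁ E₂ : E₁ × E₂ →L[ℂ] E₂ × E₁) (prodPeriod Φ₁ Φ₂ x) := by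
  rw [swap_mulVec_TPS, prodPeriod_apply, prodPeriod_apply]
  rfl

/-- **The exchange morphism `s : (Y × Z, ω₁ ⊞ ω₂) ⥲ (Z × Y, ω₂ ⊞ ω₁)` is an isomorphism of polarised tori**, acting on
components by `(t₁, t₂) ↦ (t₂, t₁)` (rational representation the block permutation matrix, analytic representation
`(u, w) ↦ (w, u)`, which pulls `ω₂ ⊞ ω₁` back to `ω₁ ⊞ ω₂`). [cite: Lange2023AbelianVarietiesComplex, §6.2.2 (p. 304: the exchange morphism `s`) and §3.1.2 Prop. 3.1.4 (p. 160)] [cite: Auffarth2016NonSimplePPAV, §3 Thm. 3.5 ("`ℤ/2ℤ` interchanges the factors")] -/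
theorem exists_isPolarizedIso_swap :
    ∃ s : ComplexTorus (prodPeriod Φ₁ Φ₂) ≃+ ComplexTorus (prodPeriod Φ₂ Φ₁),
      IsPolarizedIso (prodPeriod Φ₁ Φ₂) (prodForm ω₁ ω₂) (prodPeriod Φ₂ Φ₁) (prodForm ω₂ ω₁) s ∧
        ∀ t, prodHomeomorph Φ₂ Φ₁ (s t) = ((prodHomeomorph Φ₁ Φ₂ t).2, (prodHomeomorph Φ₁ Φ₂ t).1) := by
  obtain ⟨s, hs, hcoe, -⟩ := exists_isPolarizedIso_of_matrix (Φ := prodPeriod Φ₁ Φ₂) (Φ' := prodPeriod Φ₂ Φ₁)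
    (η := prodForm ω₁ ω₂) (η' := prodForm ω₂ ω₁) (swap_mul_swap_TPS (ι₁ := ι₁) (ι₂ := ι₂))
    (swap_mul_swap_TPS (ι₁ := ι₂) (ι₂ := ι₁)) (ContinuousLinearEquiv.prodComm ℂ E₁ E₂ : E₁ × E₂ →L[ℂ] E₂ × E₁)
    (prodPeriod_swap_mulVec_eq_prodComm Φ₁ Φ₂) fun u v ↦ by
      have hC : ∀ w : E₁ × E₂,
          (ContinuousLinearEquiv.prodComm ℂ E₁ E₂ : E₁ × E₂ →L[ℂ] E₂ × E₁) w = (w.2, w.1) := fun _ ↦ rfl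
      rw [hC, hC, prodForm_apply, prodForm_apply]
      exact add_comm _ _
  refine ⟨s, hs, fun t ↦ ?_⟩
  obtain ⟨x, rfl⟩ : ∃ x, proj (prodPeriod Φ₁ Φ₂) x = t := ⟨lift _ t, proj_lift _ t⟩
  rw [hcoe, mapMatrix_proj, swap_mulVec_TPS, prodHomeomorph_proj, prodHomeomorph_proj]
  rfl

variable {Φ₁ Φ₂} {s : ComplexTorus (prodPeriod Φ₁ Φ₂) ≃+ ComplexTorus (prodPeriod Φ₂ Φ₁)}
  (hc : ∀ t, prodHomeomorph Φ₂ Φ₁ (s t) = ((prodHomeomorph Φ₁ Φ₂ t).2, (prodHomeomorph Φ₁ Φ₂ t).1))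

include hc in
omit [DecidableEq ι₁] [DecidableEq ι₂] in
/-- The exchange morphism carries `Y × 0` onto `0 × Y`. [cite: Lange2023AbelianVarietiesComplex, §2.4.4 Cor. 2.4.24 (p. 123) and §6.2.2 (p. 304)] -/
theorem apply_swap_mem_subtorus_sndSubspace_iff (t : ComplexTorus (prodPeriod Φ₁ Φ₂)) :
    s t ∈ subtorus (prodPeriod Φ₂ Φ₁) (sndSubspace : Submodule ℝ (ι₂ ⊕ ι₁ → ℝ)) ↔
      t ∈ subtorus (prodPeriod Φ₁ Φ₂) (fstSubspace : Submodule ℝ (ι₁ ⊕ ι₂ → ℝ)) := by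
  rw [mem_subtorus_sndSubspace_iff, mem_subtorus_fstSubspace_iff, hc]

include hc in
omit [DecidableEq ι₁] [DecidableEq ι₂] in
/-- The exchange morphism carries `0 × Z` onto `Z × 0`. [cite: Lange2023AbelianVarietiesComplex, §2.4.4 Cor. 2.4.24 (p. 123) and §6.2.2 (p. 304)] -/
theorem apply_swap_mem_subtorus_fstSubspace_iff (t : ComplexTorus (prodPeriod Φ₁ Φ₂)) :
    s t ∈ subtorus (prodPeriod Φ₂ Φ₁) (fstSubspace : Submodule ℝ (ι₂ ⊕ ι₁ → ℝ)) ↔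
      t ∈ subtorus (prodPeriod Φ₁ Φ₂) (sndSubspace : Submodule ℝ (ι₁ ⊕ ι₂ → ℝ)) := by
  rw [mem_subtorus_fstSubspace_iff, mem_subtorus_sndSubspace_iff, hc]

include hc in
omit [DecidableEq ι₁] [DecidableEq ι₂] in
/-- `s(Y × 0) = 0 × Y` as subgroups. [cite: Lange2023AbelianVarietiesComplex, §2.4.4 Cor. 2.4.24 (p. 123) and §6.2.2 (p. 304)] -/
theorem map_swap_subtorus_fstSubspace_eq :
    (subtorus (prodPeriod Φ₁ Φ₂) (fstSubspace : Submodule ℝ (ι₁ ⊕ ι₂ → ℝ))).map s.toAddMonoidHom =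
      subtorus (prodPeriod Φ₂ Φ₁) (sndSubspace : Submodule ℝ (ι₂ ⊕ ι₁ → ℝ)) := by
  ext t'
  constructor
  · rintro ⟨t, ht, rfl⟩
    exact (apply_swap_mem_subtorus_sndSubspace_iff hc t).2 ht
  · intro ht'
    exact ⟨s.symm t', (apply_swap_mem_subtorus_sndSubspace_iff hc _).1 (by rwa [s.apply_symm_apply]),
      s.apply_symm_apply t'⟩

include hc in
omit [DecidableEq ι₁] [DecidableEq ι₂] in
/-- `s(0 × Z) = Z × 0` as subgroups. [cite: Lange2023AbelianVarietiesComplex, §2.4.4 Cor. 2.4.24 (p. 123) and §6.2.2 (p. 304)] -/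
theorem map_swap_subtorus_sndSubspace_eq :
    (subtorus (prodPeriod Φ₁ Φ₂) (sndSubspace : Submodule ℝ (ι₁ ⊕ ι₂ → ℝ))).map s.toAddMonoidHom =
      subtorus (prodPeriod Φ₂ Φ₁) (fstSubspace : Submodule ℝ (ι₂ ⊕ ι₁ → ℝ)) := by
  ext t'
  constructor
  · rintro ⟨t, ht, rfl⟩
    exact (apply_swap_mem_subtorus_fstSubspace_iff hc t).2 ht
  · intro ht'
    exact ⟨s.symm t', (apply_swap_mem_subtorus_fstSubspace_iff hc _).1 (by rwa [s.apply_symm_apply]),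
      s.apply_symm_apply t'⟩

/-! ### §2 `s(graph(e)) = graph(e⁻¹)` -/

variable {K₁ : AddSubgroup (ComplexTorus Φ₁)} {K₂ : AddSubgroup (ComplexTorus Φ₂)}

include hc in
omit [DecidableEq ι₁] [DecidableEq ι₂] in
/-- **`s(graph(e)) = graph(e⁻¹)`**: `(t₁, t₂)` lies on the graph of `e : K₁ ≅ K₂` iff `(t₂, t₁)` lies on the graph of
`e⁻¹ : K₂ ≅ K₁`. [cite: Auffarth2016NonSimplePPAV, §3 Thm. 3.5 (proof, p. 10: "switching the two factors leaves the fibers invariant")] -/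
theorem apply_mem_graphSubgroup_symm_iff (e : K₁ ≃+ K₂) (t : ComplexTorus (prodPeriod Φ₁ Φ₂)) :
    s t ∈ graphSubgroup K₂ K₁ e.symm.toAddMonoidHom ↔ t ∈ graphSubgroup K₁ K₂ e.toAddMonoidHom := by
  rw [mem_graphSubgroup_iff_exists, mem_graphSubgroup_iff_exists, hc]
  simp only [AddEquiv.coe_toAddMonoidHom]
  constructor
  · rintro ⟨h2, h1⟩
    have hs : (prodHomeomorph Φ₁ Φ₂ t).1 ∈ K₁ := by rw [h1]; exact SetLike.coe_mem _
    refine ⟨hs, ?_⟩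
    have h3 : (⟨(prodHomeomorph Φ₁ Φ₂ t).1, hs⟩ : K₁) = e.symm ⟨(prodHomeomorph Φ₁ Φ₂ t).2, h2⟩ := Subtype.ext h1
    rw [h3, e.apply_symm_apply]
  · rintro ⟨h1, h2⟩
    have hs : (prodHomeomorph Φ₁ Φ₂ t).2 ∈ K₂ := by rw [h2]; exact SetLike.coe_mem _
    refine ⟨hs, ?_⟩
    have h3 : (⟨(prodHomeomorph Φ₁ Φ₂ t).2, hs⟩ : K₂) = e ⟨(prodHomeomorph Φ₁ Φ₂ t).1, h1⟩ := Subtype.ext h2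
    rw [h3, e.symm_apply_apply]

/-! ### §3 `(Y × Z)/graph(e) ≅ (Z × Y)/graph(e⁻¹)` as polarised tori -/

/-- **Auffarth 2016, Thm. 3.5, the `ℤ/2ℤ`: switching the factors.**  For a group isomorphism `e : K₁ ≅ K₂` between
subgroups of `Y`, `Z` with finite graph, the exchange morphism `s : (Y × Z, ω₁ ⊞ ω₂) ⥲ (Z × Y, ω₂ ⊞ ω₁)` descends to an
isomorphism of POLARISED tori `k : ((Y × Z)/graph(e), ω₁ ⊞ ω₂) ⥲ ((Z × Y)/graph(e⁻¹), ω₂ ⊞ ω₁)` with `k ∘ π = π' ∘ s`,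
carrying the image of `Y × 0` onto the image of `0 × Y` and the image of `0 × Z` onto that of `Z × 0` ("switching the
two factors leaves the fibers invariant": the twisted products of `(Y, Z, e)` and `(Z, Y, e⁻¹)` are the same
polarised torus, with the complementary pair listed in the other order).
[cite: Auffarth2016NonSimplePPAV, §3 Thm. 3.5 (pp. 9–10)] [cite: IribarLopez2024NoetherLefschetzCycles, §2.2 Lemma 10 and Remark 11 (pp. 7–8)] [cite: Lange2023AbelianVarietiesComplex, §1.1.2 (pp. 21–22) and §3.1.2 Prop. 3.1.4 (p. 160)] -/
theorem exists_isPolarizedIso_quotientBy_graphSubgroup_swap (e : K₁ ≃+ K₂)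
    [Finite (graphSubgroup K₁ K₂ e.toAddMonoidHom)] [Finite (graphSubgroup K₂ K₁ e.symm.toAddMonoidHom)] :
    ∃ (s : ComplexTorus (prodPeriod Φ₁ Φ₂) ≃+ ComplexTorus (prodPeriod Φ₂ Φ₁))
      (k : ComplexTorus (quotientByPeriod (prodPeriod Φ₁ Φ₂) (graphSubgroup K₁ K₂ e.toAddMonoidHom)) ≃+
        ComplexTorus (quotientByPeriod (prodPeriod Φ₂ Φ₁) (graphSubgroup K₂ K₁ e.symm.toAddMonoidHom))),
      IsPolarizedIso (prodPeriod Φ₁ Φ₂) (prodForm ω₁ ω₂) (prodPeriod Φ₂ Φ₁) (prodForm ω₂ ω₁) s ∧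
      (∀ t, prodHomeomorph Φ₂ Φ₁ (s t) = ((prodHomeomorph Φ₁ Φ₂ t).2, (prodHomeomorph Φ₁ Φ₂ t).1)) ∧
      IsPolarizedIso (quotientByPeriod (prodPeriod Φ₁ Φ₂) (graphSubgroup K₁ K₂ e.toAddMonoidHom)) (prodForm ω₁ ω₂)
        (quotientByPeriod (prodPeriod Φ₂ Φ₁) (graphSubgroup K₂ K₁ e.symm.toAddMonoidHom)) (prodForm ω₂ ω₁) k ∧
      (∀ t, k (mapMatrix (prodPeriod Φ₁ Φ₂) (quotientByPeriod (prodPeriod Φ₁ Φ₂) (graphSubgroup K₁ K₂ e.toAddMonoidHom))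
          (quotientMatrix (prodPeriod Φ₁ Φ₂) (graphSubgroup K₁ K₂ e.toAddMonoidHom)) t) =
        mapMatrix (prodPeriod Φ₂ Φ₁) (quotientByPeriod (prodPeriod Φ₂ Φ₁) (graphSubgroup K₂ K₁ e.symm.toAddMonoidHom))
          (quotientMatrix (prodPeriod Φ₂ Φ₁) (graphSubgroup K₂ K₁ e.symm.toAddMonoidHom)) (s t)) ∧
      ((subtorus (prodPeriod Φ₁ Φ₂) (fstSubspace : Submodule ℝ (ι₁ ⊕ ι₂ → ℝ))).map
          (mapMatrixHom (prodPeriod Φ₁ Φ₂) (quotientByPeriod (prodPeriod Φ₁ Φ₂) (graphSubgroup K₁ K₂ e.toAddMonoidHom))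
            (quotientMatrix (prodPeriod Φ₁ Φ₂) (graphSubgroup K₁ K₂ e.toAddMonoidHom)))).map k.toAddMonoidHom =
        (subtorus (prodPeriod Φ₂ Φ₁) (sndSubspace : Submodule ℝ (ι₂ ⊕ ι₁ → ℝ))).map
          (mapMatrixHom (prodPeriod Φ₂ Φ₁) (quotientByPeriod (prodPeriod Φ₂ Φ₁) (graphSubgroup K₂ K₁ e.symm.toAddMonoidHom))
            (quotientMatrix (prodPeriod Φ₂ Φ₁) (graphSubgroup K₂ K₁ e.symm.toAddMonoidHom))) ∧
      ((subtorus (prodPeriod Φ₁ Φ₂) (sndSubspace : Submodule ℝ (ι₁ ⊕ ι₂ → ℝ))).map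
          (mapMatrixHom (prodPeriod Φ₁ Φ₂) (quotientByPeriod (prodPeriod Φ₁ Φ₂) (graphSubgroup K₁ K₂ e.toAddMonoidHom))
            (quotientMatrix (prodPeriod Φ₁ Φ₂) (graphSubgroup K₁ K₂ e.toAddMonoidHom)))).map k.toAddMonoidHom =
        (subtorus (prodPeriod Φ₂ Φ₁) (fstSubspace : Submodule ℝ (ι₂ ⊕ ι₁ → ℝ))).map
          (mapMatrixHom (prodPeriod Φ₂ Φ₁) (quotientByPeriod (prodPeriod Φ₂ Φ₁) (graphSubgroup K₂ K₁ e.symm.toAddMonoidHom))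
            (quotientMatrix (prodPeriod Φ₂ Φ₁) (graphSubgroup K₂ K₁ e.symm.toAddMonoidHom))) := by
  obtain ⟨s, hs, hc⟩ := exists_isPolarizedIso_swap Φ₁ Φ₂ ω₁ ω₂
  obtain ⟨k, hk, hkπ⟩ := hs.exists_isPolarizedIso_quotientBy (graphSubgroup K₁ K₂ e.toAddMonoidHom)
    (graphSubgroup K₂ K₁ e.symm.toAddMonoidHom) (apply_mem_graphSubgroup_symm_iff hc e)
  have hmap := map_map_eq_map_map_of_comp_eq
    (mapMatrixHom (prodPeriod Φ₁ Φ₂) (quotientByPeriod (prodPeriod Φ₁ Φ₂) (graphSubgroup K₁ K₂ e.toAddMonoidHom))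
      (quotientMatrix (prodPeriod Φ₁ Φ₂) (graphSubgroup K₁ K₂ e.toAddMonoidHom)))
    (mapMatrixHom (prodPeriod Φ₂ Φ₁) (quotientByPeriod (prodPeriod Φ₂ Φ₁) (graphSubgroup K₂ K₁ e.symm.toAddMonoidHom))
      (quotientMatrix (prodPeriod Φ₂ Φ₁) (graphSubgroup K₂ K₁ e.symm.toAddMonoidHom))) k hkπ
  refine ⟨s, k, hs, hc, hk, hkπ, ?_, ?_⟩
  · rw [hmap, map_swap_subtorus_fstSubspace_eq hc]
  · rw [hmap, map_swap_subtorus_sndSubspace_eq hc]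

variable {ω₁ ω₂} {G₁ : Matrix ι₁ ι₁ ℤ} {G₂ : Matrix ι₂ ι₂ ℤ}
  (hω₁ : IsRiemannForm Φ₁ ω₁) (hω₂ : IsRiemannForm Φ₂ ω₂)
  (hG₁ : G₁.map (Int.cast : ℤ → ℝ) = latticeGram Φ₁ ω₁) (hG₂ : G₂.map (Int.cast : ℤ → ℝ) = latticeGram Φ₂ ω₂)
  {e : kerPhiH Φ₁ G₁ ≃+ kerPhiH Φ₂ G₂} (ha : IsAntisymplectic ω₁ ω₂ e.toAddMonoidHom)

include hω₁ hω₂ hG₁ hG₂ ha in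
/-- **Switching the factors of Debarre's construction.**  For polarised tori `(Y, ω₁)`, `(Z, ω₂)` (Riemann forms,
integer Gram matrices) and an ANTISYMPLECTIC isomorphism `e : K(L₁) ≅ K(L₂)`: `e⁻¹ : K(L₂) ≅ K(L₁)` is antisymplectic,
both twisted products `((Y × Z)/graph(e), ω₁ ⊞ ω₂)` and `((Z × Y)/graph(e⁻¹), ω₂ ⊞ ω₁)` are PRINCIPALLY polarised (A4-76),
and the exchange morphism descends to an isomorphism of principally polarised tori between them, compatible with
the projections and exchanging the complementary pairs — the twisted products of `(Y, Z, e)` and `(Z, Y, e⁻¹)` are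
the same point of `𝒜_g`. [cite: Auffarth2016NonSimplePPAV, §3 Thm. 3.5 (pp. 9–10: "switching the two factors leaves the fibers invariant")] [cite: IribarLopez2024NoetherLefschetzCycles, §2.2 Lemma 10 and Remark 11] -/
theorem exists_isPolarizedIso_quotientBy_graphSubgroup_swap_of_isAntisymplectic :
    ∃ (_ : IsAntisymplectic ω₂ ω₁ e.symm.toAddMonoidHom)
      (_ : Finite (graphSubgroup (kerPhiH Φ₁ G₁) (kerPhiH Φ₂ G₂) e.toAddMonoidHom))
      (_ : Finite (graphSubgroup (kerPhiH Φ₂ G₂) (kerPhiH Φ₁ G₁) e.symm.toAddMonoidHom))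
      (s : ComplexTorus (prodPeriod Φ₁ Φ₂) ≃+ ComplexTorus (prodPeriod Φ₂ Φ₁))
      (k : ComplexTorus (quotientByPeriod (prodPeriod Φ₁ Φ₂) (graphSubgroup (kerPhiH Φ₁ G₁) (kerPhiH Φ₂ G₂) e.toAddMonoidHom)) ≃+
        ComplexTorus (quotientByPeriod (prodPeriod Φ₂ Φ₁)
          (graphSubgroup (kerPhiH Φ₂ G₂) (kerPhiH Φ₁ G₁) e.symm.toAddMonoidHom))),
      IsPrincipalPolarization
          (quotientByPeriod (prodPeriod Φ₁ Φ₂) (graphSubgroup (kerPhiH Φ₁ G₁) (kerPhiH Φ₂ G₂) e.toAddMonoidHom))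
          (prodForm ω₁ ω₂) ∧
      IsPrincipalPolarization
          (quotientByPeriod (prodPeriod Φ₂ Φ₁) (graphSubgroup (kerPhiH Φ₂ G₂) (kerPhiH Φ₁ G₁) e.symm.toAddMonoidHom))
          (prodForm ω₂ ω₁) ∧
      IsPolarizedIso (prodPeriod Φ₁ Φ₂) (prodForm ω₁ ω₂) (prodPeriod Φ₂ Φ₁) (prodForm ω₂ ω₁) s ∧
      (∀ t, prodHomeomorph Φ₂ Φ₁ (s t) = ((prodHomeomorph Φ₁ Φ₂ t).2, (prodHomeomorph Φ₁ Φ₂ t).1)) ∧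
      IsPolarizedIso (quotientByPeriod (prodPeriod Φ₁ Φ₂) (graphSubgroup (kerPhiH Φ₁ G₁) (kerPhiH Φ₂ G₂) e.toAddMonoidHom))
        (prodForm ω₁ ω₂)
        (quotientByPeriod (prodPeriod Φ₂ Φ₁) (graphSubgroup (kerPhiH Φ₂ G₂) (kerPhiH Φ₁ G₁) e.symm.toAddMonoidHom))
        (prodForm ω₂ ω₁) k ∧
      ∀ t, k (mapMatrix (prodPeriod Φ₁ Φ₂)
          (quotientByPeriod (prodPeriod Φ₁ Φ₂) (graphSubgroup (kerPhiH Φ₁ G₁) (kerPhiH Φ₂ G₂) e.toAddMonoidHom))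
          (quotientMatrix (prodPeriod Φ₁ Φ₂) (graphSubgroup (kerPhiH Φ₁ G₁) (kerPhiH Φ₂ G₂) e.toAddMonoidHom)) t) =
        mapMatrix (prodPeriod Φ₂ Φ₁)
          (quotientByPeriod (prodPeriod Φ₂ Φ₁) (graphSubgroup (kerPhiH Φ₂ G₂) (kerPhiH Φ₁ G₁) e.symm.toAddMonoidHom))
          (quotientMatrix (prodPeriod Φ₂ Φ₁) (graphSubgroup (kerPhiH Φ₂ G₂) (kerPhiH Φ₁ G₁) e.symm.toAddMonoidHom))
          (s t) := by
  have ha' : IsAntisymplectic ω₂ ω₁ e.symm.toAddMonoidHom := ha.symm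
  haveI i1 : Finite (graphSubgroup (kerPhiH Φ₁ G₁) (kerPhiH Φ₂ G₂) e.toAddMonoidHom) := hω₁.finite_graphSubgroup hG₁ _
  haveI i2 : Finite (graphSubgroup (kerPhiH Φ₂ G₂) (kerPhiH Φ₁ G₁) e.symm.toAddMonoidHom) :=
    hω₂.finite_graphSubgroup hG₂ _
  obtain ⟨s, k, hs, hc, hk, hkπ, -, -⟩ := exists_isPolarizedIso_quotientBy_graphSubgroup_swap ω₁ ω₂ e
  exact ⟨ha', i1, i2, s, k,
    isPrincipalPolarization_quotientBy_graphSubgroup hω₁ hω₂ hG₁ hG₂ e.bijective ha,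
    isPrincipalPolarization_quotientBy_graphSubgroup hω₂ hω₁ hG₂ hG₁ e.symm.bijective ha', hs, hc, hk, hkπ⟩

end ComplexTorus

end Literature.Geometry.Kaehler

end
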